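import Literature.ModelTheory.Zilber.EACPeriodicCylinders
import Literature.ModelTheory.Zilber.EACGraphEscapeModels
import Literature.NumberTheory.Transcendental.ExpPointsExamples
import HarnessLib

/-!
# EAC cell `(3, 2)`, periodic half: certified explicit members of the two non-cylinder pieces

Typed support for the case ladder of Zilber's Exponential-Algebraic-Closedness conjecture
(`Literature.ModelTheory.Zilber.EAC`; first open rung `ECCell 3 2`).  After `EACPeriodicReduction`
and `EACPeriodicCylinders` the open cell is the conjunction of three typed OPEN pieces,
`ECCell 3 2 ↔ ECCellAperiodic 2 ∧ ECCellPeriodicStdFibNC 2 ∧ ECCellPeriodicStdDomNC 2`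
(`ecCell_three_two_iff_three_nc`): aperiodic base; base with period `e_last` and fibred
`[Δ₂]`-image (`dim [Δ₂](W ∩ G³) = 2`) and no side cylinder; base with period `e_last` and
co-dominant `[Δ₂]`-image (`dim = 3`) and no side cylinder.  The aperiodic piece has many certified
explicit members (`EACRotundityProofs`, `EACGraphFibres`, `EACGraphEscapeModels`); this file
supplies the FIRST CERTIFIED EXPLICIT MEMBERS OF THE TWO PERIODIC PIECES, with dictionaries to
systems of exponential equations that the problem side has SOLVED:

* `periodicFibModel = {x₂ = x₁², y₁ = y₂ + x₁, y₃ = y₂ + x₃} ⊆ ℂ³ × ℂ³` satisfies all ten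
  binders of `ECCellPeriodicStdFibNC 2` (`ecCellPeriodicStdFibNC_hypotheses_periodicFibModel`), and
  `periodicFibModel ∩ Γ_exp ≠ ∅ ↔ ∃ z w, e^z = e^{z²} + z ∧ e^w = e^{z²} + w`;
* `periodicDomModel = {x₂ = x₁², y₁ = y₂ + x₃, y₃ = y₂ + x₁}` satisfies all ten binders of
  `ECCellPeriodicStdDomNC 2` (`ecCellPeriodicStdDomNC_hypotheses_periodicDomModel`), and
  `periodicDomModel ∩ Γ_exp ≠ ∅ ↔ ∃ z w, e^z = e^{z²} + w ∧ e^w = e^{z²} + z`.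

Both systems are instances (`g = x₁²`, `κ = (1,1)`, `c = (1,1)`, `A = (x₁, x₂)` resp. `(x₂, x₁)`,
`g₂(κ) = 1 ≠ 0`) of the problem side's graph-escape theorem
`Summit.Schanuel.Schanuel.Theorems.exists_expPoint_graphEscape_powers`; the two-line composition
is problem-side (this file cannot import `Summits`) and is not claimed here.  (In 1-indexed
coordinates as above; the Lean text is 0-indexed: `inl 1 = (inl 0)², …`, `last = 2`.)

Method (no new analysis).  Both models are the images of graph-fibre varieties
`W(x₁²; P)` of `EACGraphFibres` (graph coordinate LAST, base period `e₂`) under the coordinate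
permutation `(2 3)` of both factors, i.e. the lattice change `Φ_U` of `EACMonomialChange` for the
permutation matrix `U = P_{(2 3)}` (`latticeChange_permMat`, `latticeClosure_permMat`: for a
permutation matrix `W^U` is just the coordinate-permuted copy of `W`, via the general
`zeroLocus_vanishingIdeal_image_comp_equiv`).  The first seven binders move by
`cell_hypotheses_latticeClosure`, the period vector by `isPeriodVec_image_intLinMap` (`U e₂ = e₃`);
the fibre dimension of `[Δ₂]` and the absence of side cylinders are computed on the explicit sets
(`zariskiDim_le_of_coord_polys`, `le_zariskiDim_of_algebraicIndependent`).

HONEST FRAMING.  Bookkeeping for modest rungs of EAC: the two models show that the typed periodic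
pieces are populated by varieties whose exponential systems are within reach of the problem side's
escape theorems; nothing here proves a case of EAC, `ECCell 3 2` and all three pieces remain OPEN,
and nothing here bears on Schanuel's conjecture (EAC is a different statement; EAC ⇏ SC).  No
statement of this file is a cited literature fact; the `[cite:]` tags attribute the QUESTION
(Mantova–Masser's open case `dim π(V) = 2` in `ℂ³ × (ℂˣ)³`, and their "Further remarks" on the
unprojected case); all theorems are proved here.

Sources: Mantova–Masser 2024 (MantovaMasser2023, arXiv:2303.05592) §1 p. 5; Zilber 2005 §3;
Bays–Kirby 2018 Def. 7.1.
-/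

noncomputable section

open MvPolynomial

namespace Literature.ModelTheory.Zilber

open Literature.NumberTheory.Transcendental

/-! ### Permutation matrices as lattice changes -/

section CoordPerm

variable {K : Type*} [Field K] {n : ℕ}

/-- The permutation matrix `P_σ ∈ GLₙ(ℤ)` with `(P_σ x)ᵢ = x_{σ i}`. [folklore] -/
def permMat (σ : Equiv.Perm (Fin n)) : Matrix (Fin n) (Fin n) ℤ :=
  Matrix.of fun i j => if j = σ i then 1 else 0

/-- Entries of `P_σ`. [folklore] -/
@[simp] theorem permMat_apply (σ : Equiv.Perm (Fin n)) (i j : Fin n) :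
    permMat σ i j = if j = σ i then 1 else 0 := rfl

/-- `P_σ P_τ = P_{τ ∘ σ}` (in `Equiv.trans` order). [folklore] -/
theorem permMat_mul (σ τ : Equiv.Perm (Fin n)) : permMat σ * permMat τ = permMat (σ.trans τ) := by
  ext i k
  rw [Matrix.mul_apply, Finset.sum_eq_single_of_mem (σ i) (Finset.mem_univ _)
    (fun j _ hj => by rw [permMat_apply, if_neg hj, zero_mul])]
  rw [permMat_apply, permMat_apply, permMat_apply, if_pos rfl, one_mul, Equiv.trans_apply]

/-- `P_id = 1`. [folklore] -/
theorem permMat_refl : permMat (Equiv.refl (Fin n)) = 1 := by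
  ext i k
  rw [permMat_apply, Matrix.one_apply, Equiv.refl_apply]
  exact if_congr eq_comm rfl rfl

/-- `P_σ P_{σ⁻¹} = 1`. [folklore] -/
theorem permMat_mul_permMat_symm (σ : Equiv.Perm (Fin n)) : permMat σ * permMat σ.symm = 1 := by
  rw [permMat_mul, Equiv.self_trans_symm, permMat_refl]

/-- `P_{σ⁻¹} P_σ = 1`. [folklore] -/
theorem permMat_symm_mul_permMat (σ : Equiv.Perm (Fin n)) : permMat σ.symm * permMat σ = 1 := by
  rw [permMat_mul, Equiv.symm_trans_self, permMat_refl]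

/-- `P_σ v = v ∘ σ` on integer vectors. [folklore] -/
theorem permMat_mulVec (σ : Equiv.Perm (Fin n)) (v : Fin n → ℤ) :
    Matrix.mulVec (permMat σ) v = fun i => v (σ i) := by
  funext i
  rw [Matrix.mulVec, dotProduct, Finset.sum_eq_single_of_mem (σ i) (Finset.mem_univ _)
    (fun j _ hj => by rw [permMat_apply, if_neg hj, zero_mul])]
  rw [permMat_apply, if_pos rfl, one_mul]

/-- `P_σ x = x ∘ σ` on `Kⁿ`. [folklore] -/
theorem intLinMap_permMat (σ : Equiv.Perm (Fin n)) (x : Fin n → K) :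
    intLinMap (permMat σ) x = fun i => x (σ i) := by
  funext i
  simp only [intLinMap]
  rw [Finset.sum_eq_single_of_mem (σ i) (Finset.mem_univ _)
    (fun j _ hj => by rw [permMat_apply, if_neg hj, Int.cast_zero, zero_mul])]
  rw [permMat_apply, if_pos rfl, Int.cast_one, one_mul]

/-- `y^{P_σ} = y ∘ σ`. [folklore] -/
theorem monomialMap_permMat (σ : Equiv.Perm (Fin n)) (y : Fin n → K) :
    monomialMap (permMat σ) y = fun i => y (σ i) := by
  funext i
  simp only [monomialMap]
  rw [Finset.prod_eq_single_of_mem (σ i) (Finset.mem_univ _)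
    (fun j _ hj => by rw [permMat_apply, if_neg hj, zpow_zero])]
  rw [permMat_apply, if_pos rfl, zpow_one]

/-- **The lattice change of a permutation matrix is the coordinate permutation**
`Φ_{P_σ} z = z ∘ (σ ⊕ σ)`. [folklore] -/
theorem latticeChange_permMat (σ : Equiv.Perm (Fin n)) (z : Fin n ⊕ Fin n → K) :
    latticeChange (permMat σ) z = z ∘ Sum.map σ σ := by
  funext i
  cases i with
  | inl i => rw [latticeChange_inl, intLinMap_permMat]; rfl
  | inr i => rw [latticeChange_inr, monomialMap_permMat]; rfl

/-- `Φ_{P_σ}(W ∩ Gⁿ) = (W ∩ Gⁿ) ∘ (σ ⊕ σ)`. [folklore] -/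
theorem latticeImage_permMat (σ : Equiv.Perm (Fin n)) (W : Set (Fin n ⊕ Fin n → K)) :
    latticeImage (permMat σ) W = (fun z => z ∘ Sum.map σ σ) '' (W ∩ torusLocus K n) := by
  rw [latticeImage, show (latticeChange (permMat σ) : (Fin n ⊕ Fin n → K) → Fin n ⊕ Fin n → K) =
    fun z => z ∘ Sum.map σ σ from funext (latticeChange_permMat σ)]

end CoordPerm

/-! ### Zariski closure commutes with coordinate permutations -/

section CompEquiv

variable {L : Type*} {ι : Type*}

/-- The image under `x ↦ x ∘ e` is the preimage under `x ↦ x ∘ e⁻¹`. [folklore] -/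
theorem image_comp_equiv (e : ι ≃ ι) (S : Set (ι → L)) :
    (fun x : ι → L => x ∘ e) '' S = {x | x ∘ e.symm ∈ S} := by
  ext x
  constructor
  · rintro ⟨w, hw, rfl⟩
    show (w ∘ e) ∘ e.symm ∈ S
    rwa [Function.comp_assoc, Equiv.self_comp_symm, Function.comp_id]
  · intro hx
    exact ⟨x ∘ e.symm, hx, funext fun i => by simp⟩

variable [Field L]

/-- **`Z(I(S ∘ e)) = Z(I(S)) ∘ e`**: the Zariski closure commutes with a permutation of the
coordinates (`rename e` is a ring automorphism). [folklore] -/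
theorem zeroLocus_vanishingIdeal_image_comp_equiv (e : ι ≃ ι) (S : Set (ι → L)) :
    zeroLocus L (vanishingIdeal L ((fun x : ι → L => x ∘ e) '' S)) =
      (fun x : ι → L => x ∘ e) '' zeroLocus L (vanishingIdeal L S) := by
  ext x
  constructor
  · intro hx
    refine ⟨x ∘ e.symm, ?_, funext fun i => by simp⟩
    rw [mem_zeroLocus_iff]
    intro q hq
    have hq' : rename e.symm q ∈ vanishingIdeal L ((fun x : ι → L => x ∘ e) '' S) := by
      rw [mem_vanishingIdeal_iff]
      rintro _ ⟨s, hs, rfl⟩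
      rw [aeval_rename, Function.comp_assoc, Equiv.self_comp_symm, Function.comp_id]
      exact (mem_vanishingIdeal_iff.1 hq) s hs
    have h0 := (mem_zeroLocus_iff.1 hx) _ hq'
    rwa [aeval_rename] at h0
  · rintro ⟨w, hw, rfl⟩
    rw [mem_zeroLocus_iff]
    intro p hp
    have hp' : rename e p ∈ vanishingIdeal L S := by
      rw [mem_vanishingIdeal_iff]
      intro s hs
      rw [aeval_rename]
      exact (mem_vanishingIdeal_iff.1 hp) _ ⟨s, hs, rfl⟩
    have h0 := (mem_zeroLocus_iff.1 hw) _ hp'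
    rwa [aeval_rename] at h0

end CompEquiv

section PermClosure

variable {K : Type*} [Field K] {n : ℕ}

/-- **For a permutation matrix, `W^{P_σ}` is the coordinate-permuted copy of `W`**:
`Z(I(Φ_{P_σ}(W ∩ Gⁿ))) = W ∘ (σ ⊕ σ)` for irreducible closed `W` meeting `Gⁿ`. [folklore] -/
theorem latticeClosure_permMat (σ : Equiv.Perm (Fin n)) {W : Set (Fin n ⊕ Fin n → K)}
    (hW : IsIrreducibleClosed K W) (hne : (W ∩ torusLocus K n).Nonempty) :
    latticeClosure (permMat σ) W = (fun z => z ∘ Sum.map σ σ) '' W := by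
  have he : (fun z : Fin n ⊕ Fin n → K => z ∘ Sum.map σ σ) =
      fun z => z ∘ ⇑(Equiv.sumCongr σ σ) := rfl
  unfold latticeClosure
  rw [latticeImage_permMat, he, zeroLocus_vanishingIdeal_image_comp_equiv,
    vanishingIdeal_inter_torusLocus_of_irred hW hne, zeroLocus_vanishingIdeal_of_isZariskiClosed hW.1]

/-- Point form: `z ∈ W^{P_σ} ↔ z ∘ (σ⁻¹ ⊕ σ⁻¹) ∈ W`. [folklore] -/
theorem mem_latticeClosure_permMat_iff (σ : Equiv.Perm (Fin n)) {W : Set (Fin n ⊕ Fin n → K)}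
    (hW : IsIrreducibleClosed K W) (hne : (W ∩ torusLocus K n).Nonempty)
    (z : Fin n ⊕ Fin n → K) :
    z ∈ latticeClosure (permMat σ) W ↔ z ∘ Sum.map σ.symm σ.symm ∈ W := by
  rw [latticeClosure_permMat σ hW hne]
  have h := image_comp_equiv (L := K) (Equiv.sumCongr σ σ) W
  rw [Equiv.sumCongr_symm] at h
  exact (Set.ext_iff.1 h) z

end PermClosure

/-! ### Period vectors of graph bases and of graph-fibre varieties -/

section PeriodVec

variable {s : ℕ}

/-- `IsPeriodVec` only depends on the vanishing ideal. [folklore] -/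
theorem isPeriodVec_congr {F : Type*} [Field F] {m : ℕ} {S T : Set (Fin m → F)}
    (h : vanishingIdeal F S = vanishingIdeal F T) (v : Fin m → ℤ) :
    IsPeriodVec F S v ↔ IsPeriodVec F T v := by
  simp only [IsPeriodVec, h]

/-- **Point criterion for period vectors of a graph base**: if `g(x' + v') = g(x') + v_last`
identically then `v` is a period vector of `B_g`. [folklore] -/
theorem isPeriodVec_graphBase_of_eval (g : MvPolynomial (Fin s) ℂ) (v : Fin (s + 1) → ℤ)
    (h : ∀ x : Fin s → ℂ, eval (x + fun i => (v (Fin.castSucc i) : ℂ)) g =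
      eval x g + (v (Fin.last s) : ℂ)) :
    IsPeriodVec ℂ (graphBase g) v := by
  rw [isPeriodVec_iff, zeroLocus_vanishingIdeal_of_isZariskiClosed (isZariskiClosed_graphBase g)]
  intro x hx
  simp only [graphBase, Set.mem_setOf_eq, Pi.add_apply] at hx ⊢
  rw [hx, ← h fun i => x (Fin.castSucc i)]
  rfl

/-- The vanishing ideal of the additive base of `W(g; P)` is that of `B_g` (dominant slice).
[folklore] -/
theorem vanishingIdeal_projAdd_graphFibreVariety (g : MvPolynomial (Fin s) ℂ)
    (P : Fin s → MvPolynomial (Fin (s + 1)) ℂ) (u₀ : ℂ)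
    (hP : Function.Injective (aeval (fibreSlice P u₀) :
      MvPolynomial (Fin s) ℂ →ₐ[ℂ] MvPolynomial (Fin s) ℂ)) :
    vanishingIdeal ℂ (projAdd '' (graphFibreVariety g P ∩ torusLocus ℂ (s + 1))) =
      vanishingIdeal ℂ (graphBase g) := by
  rw [graphFibreVariety_eq_polyFibredGraph,
    vanishingIdeal_projAdd_polyFibredGraph_of_injective g _ _ (mulSubstInjective_of_fibreSlice P u₀ hP),
    vanishingIdeal_graphBase]

/-- Hence a period vector of `B_g` is one of the base of `W(g; P)` (dominant slice). [folklore] -/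
theorem isPeriodVec_projAdd_graphFibreVariety (g : MvPolynomial (Fin s) ℂ)
    (P : Fin s → MvPolynomial (Fin (s + 1)) ℂ) (u₀ : ℂ)
    (hP : Function.Injective (aeval (fibreSlice P u₀) :
      MvPolynomial (Fin s) ℂ →ₐ[ℂ] MvPolynomial (Fin s) ℂ))
    {v : Fin (s + 1) → ℤ} (hv : IsPeriodVec ℂ (graphBase g) v) :
    IsPeriodVec ℂ (projAdd '' (graphFibreVariety g P ∩ torusLocus ℂ (s + 1))) v :=
  (isPeriodVec_congr (vanishingIdeal_projAdd_graphFibreVariety g P u₀ hP) v).2 hv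

end PeriodVec

/-! ### The projection `[Δ_d]` in coordinates -/

section DropLast

variable {K : Type*} [Field K] {d : ℕ}

/-- Additive coordinates of `[Δ_d] z`: `xᵢ` for `i ≠ last`, `0` for `i = last`. [folklore] -/
theorem matrixAct_dropLastMat_inl (z : Fin (d + 1) ⊕ Fin (d + 1) → K) (i : Fin (d + 1)) :
    matrixAct (dropLastMat d) z (Sum.inl i) = if i = Fin.last d then 0 else z (Sum.inl i) := by
  rw [matrixAct_inl, Finset.sum_eq_single_of_mem i (Finset.mem_univ _)
    (fun j _ hj => by rw [dropLastMat, Matrix.diagonal_apply_ne _ (Ne.symm hj), Int.cast_zero,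
      zero_mul])]
  rw [dropLastMat, Matrix.diagonal_apply_eq]
  split_ifs <;> simp

/-- Multiplicative coordinates of `[Δ_d] z`: `yᵢ` for `i ≠ last`, `1` for `i = last`. [folklore] -/
theorem matrixAct_dropLastMat_inr (z : Fin (d + 1) ⊕ Fin (d + 1) → K) (i : Fin (d + 1)) :
    matrixAct (dropLastMat d) z (Sum.inr i) = if i = Fin.last d then 1 else z (Sum.inr i) := by
  rw [matrixAct_inr, Finset.prod_eq_single_of_mem i (Finset.mem_univ _)
    (fun j _ hj => by rw [dropLastMat, Matrix.diagonal_apply_ne _ (Ne.symm hj), zpow_zero])]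
  rw [dropLastMat, Matrix.diagonal_apply_eq]
  split_ifs <;> simp

end DropLast

/-! ### The two models: base `x₂ = x₁²`, period `e₂` before / `e₃` after the permutation `(2 3)` -/

section Models

/-- The base polynomial `x₁²` (a parabolic cylinder `x_last = x₁²`, period `e₂`). [folklore] -/
def sqBase : MvPolynomial (Fin 2) ℂ := X 0 ^ 2

/-- Evaluation of the base. [folklore] -/
theorem eval_sqBase (x : Fin 2 → ℂ) : eval x sqBase = x 0 ^ 2 := by
  simp [sqBase, map_pow, eval_X]

/-- `deg x₁² = 2`. [folklore] -/
theorem totalDegree_sqBase : sqBase.totalDegree = 2 := by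
  rw [sqBase, totalDegree_X_pow]

/-- `e₂` (0-indexed: `Pi.single 1 1`) is a period vector of the base `x₃ = x₁²`. [folklore] -/
theorem isPeriodVec_graphBase_sqBase :
    IsPeriodVec ℂ (graphBase sqBase) (Pi.single (1 : Fin (2 + 1)) 1) :=
  isPeriodVec_graphBase_of_eval sqBase _ fun x => by
    simp [eval_sqBase, Fin.ext_iff]

/-- The permutation `(2 3)` of `Fin 3` (0-indexed: `swap 1 2`). [folklore] -/
def swap12 : Equiv.Perm (Fin 3) := Equiv.swap 1 2

/-- `(2 3)` fixes the first coordinate. [folklore] -/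
@[simp] theorem swap12_apply_zero : swap12 0 = 0 := by decide

/-- `(2 3)` sends the second coordinate to the third. [folklore] -/
@[simp] theorem swap12_apply_one : swap12 1 = 2 := by decide

/-- `(2 3)` sends the third coordinate to the second. [folklore] -/
@[simp] theorem swap12_apply_two : swap12 2 = 1 := by decide


/-- `P_{(2 3)}` is an involution: `P P = 1`. [folklore] -/
theorem permMat_swap12_mul_self : permMat swap12 * permMat swap12 = 1 := by
  have h := permMat_mul_permMat_symm swap12
  rwa [show swap12.symm = swap12 from Equiv.symm_swap 1 2] at h

/-- `P_{(2 3)} e₂ = e₃` (0-indexed: `P (single 1 1) = single (last 2) 1`). [folklore] -/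
theorem permMat_swap12_mulVec_single :
    Matrix.mulVec (permMat swap12) (Pi.single (1 : Fin (2 + 1)) 1) = Pi.single (Fin.last 2) 1 := by
  rw [permMat_mulVec]
  funext i
  fin_cases i <;> simp [Fin.ext_iff]

/-- The decoupled offset fibres `(u + x₁, u + x₂) ∈ ℂ[u, x₁, x₂]²`. [folklore] -/
def offsetFibrePoly : Fin 2 → MvPolynomial (Fin (2 + 1)) ℂ := ![X 0 + X 1, X 0 + X 2]

/-- The slice of the offset fibres at `u₀ = 0` is the identity `(x₁, x₂)`. [folklore] -/
theorem fibreSlice_offsetFibrePoly_zero :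
    fibreSlice offsetFibrePoly 0 = (X : Fin 2 → MvPolynomial (Fin 2) ℂ) := by
  funext j
  fin_cases j <;> simp [fibreSlice, offsetFibrePoly]

/-- The identity slice is dominant. [folklore] -/
theorem aeval_X_injective_two :
    Function.Injective (aeval (X : Fin 2 → MvPolynomial (Fin 2) ℂ) :
      MvPolynomial (Fin 2) ℂ →ₐ[ℂ] MvPolynomial (Fin 2) ℂ) := fun p q h => by
  simpa only [aeval_X_left_apply] using h

/-- **Pre-model (graph coordinate last)** `W₀ = {x₃ = x₁², y₁ = y₃ + x₁, y₂ = y₃ + x₂}`: a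
graph-fibre variety over the parabolic cylinder, base period `e₂`.
[cite: MantovaMasser2023, §1 p. 5 (the open case dim π(V) = 2 in ℂ³ × (ℂˣ)³)] -/
def preFibModel : Set (Fin 3 ⊕ Fin 3 → ℂ) := graphFibreVariety sqBase offsetFibrePoly

/-- **Pre-model (graph coordinate last)** `W₀' = {x₃ = x₁², y₁ = y₃ + x₂, y₂ = y₃ + x₁}`.
[cite: MantovaMasser2023, §1 p. 5 (the open case dim π(V) = 2 in ℂ³ × (ℂˣ)³)] -/
def preDomModel : Set (Fin 3 ⊕ Fin 3 → ℂ) := graphFibreVariety sqBase swapOffsetFibrePoly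

/-- `W₀` satisfies the seven hypotheses of `ECCell 3 2` (binders in order). [folklore] -/
theorem ecCell_hypotheses_preFibModel :
    IsIrreducibleClosed ℂ preFibModel ∧
    (preFibModel ∩ torusLocus ℂ 3).Nonempty ∧
    IsRotund ℂ 3 (preFibModel ∩ torusLocus ℂ 3) ∧
    IsAddFree ℂ 3 (preFibModel ∩ torusLocus ℂ 3) ∧
    IsMulFree ℂ 3 (preFibModel ∩ torusLocus ℂ 3) ∧
    zariskiDim ℂ preFibModel = (3 : ℕ) ∧
    addProjDim ℂ 3 preFibModel = (2 : ℕ) :=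
  ecCell_hypotheses_graphFibreVariety sqBase offsetFibrePoly 0
    (by rw [fibreSlice_offsetFibrePoly_zero]; exact aeval_X_injective_two)
    (by rw [totalDegree_sqBase])

/-- `W₀'` satisfies the seven hypotheses of `ECCell 3 2` (binders in order). [folklore] -/
theorem ecCell_hypotheses_preDomModel :
    IsIrreducibleClosed ℂ preDomModel ∧
    (preDomModel ∩ torusLocus ℂ 3).Nonempty ∧
    IsRotund ℂ 3 (preDomModel ∩ torusLocus ℂ 3) ∧
    IsAddFree ℂ 3 (preDomModel ∩ torusLocus ℂ 3) ∧
    IsMulFree ℂ 3 (preDomModel ∩ torusLocus ℂ 3) ∧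
    zariskiDim ℂ preDomModel = (3 : ℕ) ∧
    addProjDim ℂ 3 preDomModel = (2 : ℕ) :=
  ecCell_hypotheses_graphFibreVariety sqBase swapOffsetFibrePoly 0
    (by rw [fibreSlice_swapOffsetFibrePoly_zero]; exact aeval_swap_injective) (by rw [totalDegree_sqBase])

/-- The base of `W₀` has the period vector `e₂`. [folklore] -/
theorem isPeriodVec_projAdd_preFibModel :
    IsPeriodVec ℂ (projAdd '' (preFibModel ∩ torusLocus ℂ 3)) (Pi.single (1 : Fin (2 + 1)) 1) :=
  isPeriodVec_projAdd_graphFibreVariety sqBase offsetFibrePoly 0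
    (by rw [fibreSlice_offsetFibrePoly_zero]; exact aeval_X_injective_two) isPeriodVec_graphBase_sqBase

/-- The base of `W₀'` has the period vector `e₂`. [folklore] -/
theorem isPeriodVec_projAdd_preDomModel :
    IsPeriodVec ℂ (projAdd '' (preDomModel ∩ torusLocus ℂ 3)) (Pi.single (1 : Fin (2 + 1)) 1) :=
  isPeriodVec_projAdd_graphFibreVariety sqBase swapOffsetFibrePoly 0
    (by rw [fibreSlice_swapOffsetFibrePoly_zero]; exact aeval_swap_injective)
    isPeriodVec_graphBase_sqBase

/-! ### The fibred model `{x₂ = x₁², y₁ = y₂ + x₁, y₃ = y₂ + x₃}` -/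

/-- **The periodic fibred model** `{x₂ = x₁², y₁ = y₂ + x₁, y₃ = y₂ + x₃} ⊆ ℂ³ × ℂ³`
(0-indexed in the Lean text): base the parabolic cylinder `x₂ = x₁²` with period `e₃ = e_last`,
fibres `y₁ = y₂ + x₁`, `y₃ = y₂ + x₃`; the `[Δ₂]`-image forgets `(x₃, y₃)` and is 2-dimensional
(FIBRED piece).  [cite: MantovaMasser2023, §1 Further remarks (unprojected exponential points over
curve bases)] -/
def periodicFibModel : Set (Fin 3 ⊕ Fin 3 → ℂ) :=
  {z | z (Sum.inl 1) = z (Sum.inl 0) ^ 2 ∧ z (Sum.inr 0) = z (Sum.inr 1) + z (Sum.inl 0) ∧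
    z (Sum.inr 2) = z (Sum.inr 1) + z (Sum.inl 2)}

/-- **The fibred model is the `(2 3)`-permuted copy of `W₀`**, i.e. `W₀^{P_{(2 3)}}`. [folklore] -/
theorem periodicFibModel_eq_latticeClosure :
    periodicFibModel = latticeClosure (permMat swap12) preFibModel := by
  obtain ⟨hW, hne, -⟩ := ecCell_hypotheses_preFibModel
  ext z
  rw [mem_latticeClosure_permMat_iff swap12 hW hne, show swap12.symm = swap12 from Equiv.symm_swap 1 2,
    preFibModel,
    mem_graphFibreVariety_iff, Fin.forall_fin_two]
  simp only [periodicFibModel, Set.mem_setOf_eq, Function.comp_apply, Sum.map_inl, Sum.map_inr,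
    eval_sqBase, offsetFibrePoly, Matrix.cons_val_zero, Matrix.cons_val_one, map_add, eval_X,
    Fin.cons_zero, Fin.isValue, Fin.castSucc_zero, Fin.castSucc_one, swap12_apply_zero,
    swap12_apply_one, swap12_apply_two, show (Fin.last 2) = 2 from rfl]
  all_goals exact Iff.rfl

/-- Membership in the fibred model. [folklore] -/
theorem mem_periodicFibModel_iff (z : Fin 3 ⊕ Fin 3 → ℂ) :
    z ∈ periodicFibModel ↔ z (Sum.inl 1) = z (Sum.inl 0) ^ 2 ∧
      z (Sum.inr 0) = z (Sum.inr 1) + z (Sum.inl 0) ∧ z (Sum.inr 2) = z (Sum.inr 1) + z (Sum.inl 2) :=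
  Iff.rfl

/-- The first seven cell binders of the fibred model and the transport of exponential points,
from `W₀` through `Φ_{P_{(2 3)}}`. [folklore] -/
theorem cell_hypotheses_periodicFibModel :
    IsIrreducibleClosed ℂ periodicFibModel ∧
    (periodicFibModel ∩ torusLocus ℂ 3).Nonempty ∧
    IsRotund ℂ 3 (periodicFibModel ∩ torusLocus ℂ 3) ∧
    IsAddFree ℂ 3 (periodicFibModel ∩ torusLocus ℂ 3) ∧
    IsMulFree ℂ 3 (periodicFibModel ∩ torusLocus ℂ 3) ∧
    zariskiDim ℂ periodicFibModel = (3 : ℕ) ∧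
    addProjDim ℂ 3 periodicFibModel = (2 : ℕ) ∧
    ((periodicFibModel ∩ expGraph ℂ 3).Nonempty ↔ (preFibModel ∩ expGraph ℂ 3).Nonempty) := by
  obtain ⟨hW, hne, hrot, hadd, hmul, hdim, hapd⟩ := ecCell_hypotheses_preFibModel
  rw [periodicFibModel_eq_latticeClosure]
  exact cell_hypotheses_latticeClosure permMat_swap12_mul_self permMat_swap12_mul_self hW hne hrot
    hadd hmul hdim hapd

/-- **The base of the fibred model has the period vector `e_last`.** [folklore] -/
theorem isPeriodVec_projAdd_periodicFibModel :
    IsPeriodVec ℂ (projAdd '' (periodicFibModel ∩ torusLocus ℂ 3)) (Pi.single (Fin.last 2) 1) := by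
  rw [periodicFibModel_eq_latticeClosure, projAdd_image_latticeClosure_inter permMat_swap12_mul_self
    permMat_swap12_mul_self ecCell_hypotheses_preFibModel.1.1, ← permMat_swap12_mulVec_single]
  exact isPeriodVec_image_intLinMap permMat_swap12_mul_self permMat_swap12_mul_self
    isPeriodVec_projAdd_preFibModel

/-- **The `[Δ₂]`-image of the fibred model is 2-dimensional** (its points are
`(x₁, x₁², 0; y₂ + x₁, y₂, 1)`: two free parameters). [folklore] -/
theorem zariskiDim_dropLast_periodicFibModel :
    zariskiDim ℂ (matrixAct (dropLastMat 2) '' (periodicFibModel ∩ torusLocus ℂ 3)) = (2 : ℕ) := by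
  refine le_antisymm ?_ (le_zariskiDim_image_dropLastMat cell_hypotheses_periodicFibModel.2.2.1)
  have h := zariskiDim_le_of_coord_polys
    (matrixAct (dropLastMat 2) '' (periodicFibModel ∩ torusLocus ℂ 3))
    (![Sum.inl 0, Sum.inr 1] : Fin 2 → Fin 3 ⊕ Fin 3) (by
      have key : ∀ w ∈ matrixAct (dropLastMat 2) '' (periodicFibModel ∩ torusLocus ℂ 3),
          w (Sum.inl 0) = w (Sum.inl 0) ∧ w (Sum.inl 1) = w (Sum.inl 0) ^ 2 ∧ w (Sum.inl 2) = 0 ∧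
          w (Sum.inr 0) = w (Sum.inr 1) + w (Sum.inl 0) ∧ w (Sum.inr 1) = w (Sum.inr 1) ∧
          w (Sum.inr 2) = 1 := by
        rintro _ ⟨z, ⟨hz, -⟩, rfl⟩
        obtain ⟨h1, h2, -⟩ := hz
        simp only [matrixAct_dropLastMat_inl, matrixAct_dropLastMat_inr, Fin.isValue,
          show (Fin.last 2) = 2 from rfl]
        simp [h1, h2]
      rintro (i | i) <;> fin_cases i
      · exact ⟨X 0, fun w hw => by simp⟩
      · exact ⟨X 0 ^ 2, fun w hw => by simpa using (key w hw).2.1⟩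
      · exact ⟨0, fun w hw => by simpa using (key w hw).2.2.1⟩
      · exact ⟨X 1 + X 0, fun w hw => by simpa using (key w hw).2.2.2.1⟩
      · exact ⟨X 1, fun w hw => by simp⟩
      · exact ⟨1, fun w hw => by simpa using (key w hw).2.2.2.2.2⟩)
  rwa [MvPolynomial.ringKrullDim_of_isNoetherianRing, ringKrullDim_eq_zero_of_field,
    Nat.card_eq_fintype_card, Fintype.card_fin, zero_add] at h

/-- **The fibred model has no side cylinders**: it depends on `y₁` and on `y₂`. [folklore] -/
theorem not_isCoordCylinder_periodicFibModel (i : Fin 3) (hi : i ≠ Fin.last 2) :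
    ¬ IsCoordCylinder periodicFibModel (Sum.inr i) := by
  intro h
  have hz : (Sum.elim ![0, 0, 0] ![1, 1, 1] : Fin 3 ⊕ Fin 3 → ℂ) ∈ periodicFibModel := by
    simp [mem_periodicFibModel_iff]
  have hi' : i = 0 ∨ i = 1 := by
    fin_cases i
    · exact Or.inl rfl
    · exact Or.inr rfl
    · exact absurd rfl hi
  rcases hi' with rfl | rfl
  · have h2 := (h _ hz 2).2.1
    simp only [Function.update_apply, reduceCtorEq, if_false, if_true, Sum.inr.injEq,
      Fin.isValue, Sum.elim_inl, Sum.elim_inr, Matrix.cons_val_zero, Matrix.cons_val_one] at h2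
    norm_num at h2
  · have h2 := (h _ hz 2).2.1
    simp only [Function.update_apply, reduceCtorEq, if_false, if_true, Sum.inr.injEq,
      Fin.isValue, Sum.elim_inl, Sum.elim_inr, Matrix.cons_val_zero, Matrix.cons_val_one] at h2
    norm_num at h2

/-- **The fibred model is a certified member of `ECCellPeriodicStdFibNC 2`** — all ten binders, in
order. [folklore] -/
theorem ecCellPeriodicStdFibNC_hypotheses_periodicFibModel :
    IsIrreducibleClosed ℂ periodicFibModel ∧
    (periodicFibModel ∩ torusLocus ℂ 3).Nonempty ∧
    IsRotund ℂ 3 (periodicFibModel ∩ torusLocus ℂ 3) ∧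
    IsAddFree ℂ 3 (periodicFibModel ∩ torusLocus ℂ 3) ∧
    IsMulFree ℂ 3 (periodicFibModel ∩ torusLocus ℂ 3) ∧
    zariskiDim ℂ periodicFibModel = (3 : ℕ) ∧
    addProjDim ℂ 3 periodicFibModel = (2 : ℕ) ∧
    IsPeriodVec ℂ (projAdd '' (periodicFibModel ∩ torusLocus ℂ 3)) (Pi.single (Fin.last 2) 1) ∧
    zariskiDim ℂ (matrixAct (dropLastMat 2) '' (periodicFibModel ∩ torusLocus ℂ 3)) = (2 : ℕ) ∧
    (∀ i : Fin 3, i ≠ Fin.last 2 → ¬ IsCoordCylinder periodicFibModel (Sum.inr i)) := by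
  obtain ⟨h1, h2, h3, h4, h5, h6, h7, -⟩ := cell_hypotheses_periodicFibModel
  exact ⟨h1, h2, h3, h4, h5, h6, h7, isPeriodVec_projAdd_periodicFibModel,
    zariskiDim_dropLast_periodicFibModel, not_isCoordCylinder_periodicFibModel⟩

/-- `ECCellPeriodicStdFibNC 2` ⇒ the fibred model meets `Γ_exp`. [folklore] -/
theorem periodicFibModel_inter_expGraph_nonempty_of_ecCellPeriodicStdFibNC
    (h : ECCellPeriodicStdFibNC 2) : (periodicFibModel ∩ expGraph ℂ 3).Nonempty := by
  obtain ⟨h1, h2, h3, h4, h5, h6, h7, h8, h9, h10⟩ :=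
    ecCellPeriodicStdFibNC_hypotheses_periodicFibModel
  exact h _ h1 h2 h3 h4 h5 h6 h7 h8 h9 h10

/-- **Dictionary**: the fibred model meets `Γ_exp` iff
`∃ z w, e^z = e^{z²} + z ∧ e^w = e^{z²} + w` — an instance (`g = x₁²`, `κ = (1,1)`, `c = (1,1)`,
`A = (x₁, x₂)`) of the system solved by the problem side's `exists_expPoint_graphEscape_powers`.
[folklore] -/
theorem periodicFibModel_inter_expGraph_nonempty_iff :
    (periodicFibModel ∩ expGraph ℂ 3).Nonempty ↔
      ∃ z w : ℂ, Complex.exp z = Complex.exp (z ^ 2) + z ∧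
        Complex.exp w = Complex.exp (z ^ 2) + w := by
  rw [cell_hypotheses_periodicFibModel.2.2.2.2.2.2.2, preFibModel,
    graphFibreVariety_inter_expGraph_nonempty_iff]
  have key : ∀ x : Fin 2 → ℂ,
      (∀ j, Complex.exp (x j) =
        eval (Fin.cons (Complex.exp (eval x sqBase)) x : Fin (2 + 1) → ℂ) (offsetFibrePoly j)) ↔
      (Complex.exp (x 0) = Complex.exp (x 0 ^ 2) + x 0 ∧
        Complex.exp (x 1) = Complex.exp (x 0 ^ 2) + x 1) := by
    intro x
    rw [Fin.forall_fin_two, eval_sqBase]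
    simp only [offsetFibrePoly, Matrix.cons_val_zero, Matrix.cons_val_one, map_add, eval_X,
      Fin.cons_zero, Fin.cons_one, cons_apply_two]
  constructor
  · rintro ⟨x, hx⟩
    exact ⟨x 0, x 1, (key x).1 hx⟩
  · rintro ⟨z, w, hzw⟩
    refine ⟨![z, w], (key ![z, w]).2 ?_⟩
    simpa using hzw

/-- Problem-side entry point: the conclusion shape of `exists_expPoint_graphEscape_powers` at
`g = sqBase`, `κ = (1,1)`, `c = (1,1)`, `A = X` gives an exponential point of the fibred model.
[folklore] -/
theorem periodicFibModel_inter_expGraph_nonempty_of_powers_shape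
    (h : ∃ x : Fin 2 → ℂ, ∀ j, Complex.exp (x j) =
      (![1, 1] : Fin 2 → ℂ) j * Complex.exp (eval x sqBase) ^ ((![1, 1] : Fin 2 → ℕ) j) +
        eval x (X j)) :
    (periodicFibModel ∩ expGraph ℂ 3).Nonempty := by
  rw [periodicFibModel_inter_expGraph_nonempty_iff]
  obtain ⟨x, hx⟩ := h
  refine ⟨x 0, x 1, ?_, ?_⟩
  · simpa [eval_sqBase] using hx 0
  · simpa [eval_sqBase] using hx 1

/-! ### The co-dominant model `{x₂ = x₁², y₁ = y₂ + x₃, y₃ = y₂ + x₁}` -/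

/-- **The periodic co-dominant model** `{x₂ = x₁², y₁ = y₂ + x₃, y₃ = y₂ + x₁} ⊆ ℂ³ × ℂ³`
(0-indexed in the Lean text): same base (period `e₃ = e_last`), fibres `y₁ = y₂ + x₃`,
`y₃ = y₂ + x₁`; the `[Δ₂]`-image forgets `(x₃, y₃)` but `x₃` survives in `y₁`, so the image is
3-dimensional (CO-DOMINANT piece). [cite: MantovaMasser2023, §1 Further remarks (unprojected
exponential points over curve bases)] -/
def periodicDomModel : Set (Fin 3 ⊕ Fin 3 → ℂ) :=
  {z | z (Sum.inl 1) = z (Sum.inl 0) ^ 2 ∧ z (Sum.inr 0) = z (Sum.inr 1) + z (Sum.inl 2) ∧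
    z (Sum.inr 2) = z (Sum.inr 1) + z (Sum.inl 0)}

/-- Membership in the co-dominant model. [folklore] -/
theorem mem_periodicDomModel_iff (z : Fin 3 ⊕ Fin 3 → ℂ) :
    z ∈ periodicDomModel ↔ z (Sum.inl 1) = z (Sum.inl 0) ^ 2 ∧
      z (Sum.inr 0) = z (Sum.inr 1) + z (Sum.inl 2) ∧ z (Sum.inr 2) = z (Sum.inr 1) + z (Sum.inl 0) :=
  Iff.rfl

/-- **The co-dominant model is the `(2 3)`-permuted copy of `W₀'`.** [folklore] -/
theorem periodicDomModel_eq_latticeClosure :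
    periodicDomModel = latticeClosure (permMat swap12) preDomModel := by
  obtain ⟨hW, hne, -⟩ := ecCell_hypotheses_preDomModel
  ext z
  rw [mem_latticeClosure_permMat_iff swap12 hW hne, show swap12.symm = swap12 from Equiv.symm_swap 1 2,
    preDomModel,
    mem_graphFibreVariety_iff, Fin.forall_fin_two]
  simp only [periodicDomModel, Set.mem_setOf_eq, Function.comp_apply, Sum.map_inl, Sum.map_inr,
    eval_sqBase, swapOffsetFibrePoly, Matrix.cons_val_zero, Matrix.cons_val_one, map_add, eval_X,
    Fin.cons_zero, Fin.isValue, Fin.castSucc_zero, Fin.castSucc_one, swap12_apply_zero,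
    swap12_apply_one, swap12_apply_two, show (Fin.last 2) = 2 from rfl, cons_apply_two, Fin.cons_one]

/-- The first seven cell binders of the co-dominant model and the transport of exponential
points, from `W₀'` through `Φ_{P_{(2 3)}}`. [folklore] -/
theorem cell_hypotheses_periodicDomModel :
    IsIrreducibleClosed ℂ periodicDomModel ∧
    (periodicDomModel ∩ torusLocus ℂ 3).Nonempty ∧
    IsRotund ℂ 3 (periodicDomModel ∩ torusLocus ℂ 3) ∧
    IsAddFree ℂ 3 (periodicDomModel ∩ torusLocus ℂ 3) ∧
    IsMulFree ℂ 3 (periodicDomModel ∩ torusLocus ℂ 3) ∧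
    zariskiDim ℂ periodicDomModel = (3 : ℕ) ∧
    addProjDim ℂ 3 periodicDomModel = (2 : ℕ) ∧
    ((periodicDomModel ∩ expGraph ℂ 3).Nonempty ↔ (preDomModel ∩ expGraph ℂ 3).Nonempty) := by
  obtain ⟨hW, hne, hrot, hadd, hmul, hdim, hapd⟩ := ecCell_hypotheses_preDomModel
  rw [periodicDomModel_eq_latticeClosure]
  exact cell_hypotheses_latticeClosure permMat_swap12_mul_self permMat_swap12_mul_self hW hne hrot
    hadd hmul hdim hapd

/-- **The base of the co-dominant model has the period vector `e_last`.** [folklore] -/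
theorem isPeriodVec_projAdd_periodicDomModel :
    IsPeriodVec ℂ (projAdd '' (periodicDomModel ∩ torusLocus ℂ 3)) (Pi.single (Fin.last 2) 1) := by
  rw [periodicDomModel_eq_latticeClosure, projAdd_image_latticeClosure_inter permMat_swap12_mul_self
    permMat_swap12_mul_self ecCell_hypotheses_preDomModel.1.1, ← permMat_swap12_mulVec_single]
  exact isPeriodVec_image_intLinMap permMat_swap12_mul_self permMat_swap12_mul_self
    isPeriodVec_projAdd_preDomModel

/-- The parametrisation `(a, b, c) ↦ (a, a², c; b + c, b, b + a)` of the co-dominant model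
(`a = x₁`, `b = y₂`, `c = x₃`). [folklore] -/
def domParamPoint (v : Fin 3 → ℂ) : Fin 3 ⊕ Fin 3 → ℂ :=
  Sum.elim ![v 0, v 0 ^ 2, v 2] ![v 1 + v 2, v 1, v 1 + v 0]

/-- The coordinates of `[Δ₂]` of the parametrisation, as polynomials in `(a, b, c)`:
`(a, a², 0; b + c, b, 1)`. [folklore] -/
def domParamPoly : Fin 3 ⊕ Fin 3 → MvPolynomial (Fin 3) ℂ :=
  Sum.elim ![X 0, X 0 ^ 2, 0] ![X 1 + X 2, X 1, 1]

/-- The parametrisation lands in the model. [folklore] -/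
theorem domParamPoint_mem (v : Fin 3 → ℂ) : domParamPoint v ∈ periodicDomModel := by
  simp [mem_periodicDomModel_iff, domParamPoint]

/-- … and in the torus when `b, b + c, b + a ≠ 0`. [folklore] -/
theorem domParamPoint_mem_torusLocus (v : Fin 3 → ℂ) (h1 : v 1 ≠ 0) (h2 : v 1 + v 2 ≠ 0)
    (h3 : v 1 + v 0 ≠ 0) : domParamPoint v ∈ torusLocus ℂ 3 := by
  intro i
  fin_cases i <;> simp [domParamPoint, h1, h2, h3]

/-- `[Δ₂]` of the parametrisation is the evaluation of `domParamPoly`. [folklore] -/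
theorem matrixAct_dropLastMat_domParamPoint (v : Fin 3 → ℂ) :
    matrixAct (dropLastMat 2) (domParamPoint v) = fun i => aeval v (domParamPoly i) := by
  funext i
  rcases i with i | i
  · rw [matrixAct_dropLastMat_inl]
    fin_cases i <;> simp [domParamPoint, domParamPoly, show (Fin.last 2) = 2 from rfl]
  · rw [matrixAct_dropLastMat_inr]
    fin_cases i <;> simp [domParamPoint, domParamPoly, show (Fin.last 2) = 2 from rfl]

/-- A polynomial vanishing on the `[Δ₂]`-image of the torus part of the co-dominant model vanishes
identically after the substitution `domParamPoly`. [folklore] -/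
theorem vanishingIdeal_dropLast_periodicDomModel_le_ker :
    vanishingIdeal ℂ (matrixAct (dropLastMat 2) '' (periodicDomModel ∩ torusLocus ℂ 3)) ≤
      RingHom.ker (bind₁ domParamPoly : MvPolynomial (Fin 3 ⊕ Fin 3) ℂ →ₐ[ℂ] MvPolynomial (Fin 3) ℂ) := by
  intro p hp
  rw [RingHom.mem_ker]
  have hq0 : (X 1 * ((X 1 + X 2) * (X 1 + X 0)) : MvPolynomial (Fin 3) ℂ) ≠ 0 := by
    intro h
    have h' := congrArg (eval fun _ => (1 : ℂ)) h
    norm_num [eval_X] at h'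
  have hprod : bind₁ domParamPoly p * (X 1 * ((X 1 + X 2) * (X 1 + X 0))) = 0 := by
    apply MvPolynomial.funext
    intro v
    rw [map_mul, map_zero]
    by_cases hv : eval v (X 1 * ((X 1 + X 2) * (X 1 + X 0)) : MvPolynomial (Fin 3) ℂ) = 0
    · rw [hv, mul_zero]
    · have hv' : v 1 ≠ 0 ∧ v 1 + v 2 ≠ 0 ∧ v 1 + v 0 ≠ 0 := by
        simpa [eval_X, mul_eq_zero, not_or] using hv
      have hz : domParamPoint v ∈ periodicDomModel ∩ torusLocus ℂ 3 :=
        ⟨domParamPoint_mem v, domParamPoint_mem_torusLocus v hv'.1 hv'.2.1 hv'.2.2⟩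
      have h0 := (mem_vanishingIdeal_iff.1 hp) _ ⟨_, hz, rfl⟩
      rw [matrixAct_dropLastMat_domParamPoint, ← aeval_bind₁] at h0
      rw [show eval v (bind₁ domParamPoly p) = aeval v (bind₁ domParamPoly p) from rfl, h0, zero_mul]
  exact (mul_eq_zero.1 hprod).resolve_right hq0

/-- **The `[Δ₂]`-image of the co-dominant model is 3-dimensional** (`a, b, c` are algebraically
independent coordinates on it; and it is at most `dim W = 3`). [folklore] -/
theorem zariskiDim_dropLast_periodicDomModel :
    zariskiDim ℂ (matrixAct (dropLastMat 2) '' (periodicDomModel ∩ torusLocus ℂ 3)) = (3 : ℕ) := by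
  obtain ⟨hW, hne, -, -, -, hdim, -⟩ := cell_hypotheses_periodicDomModel
  refine le_antisymm ((zariskiDim_image_dropLastMat_le hW hne).trans_eq hdim) ?_
  have hg : AlgebraicIndependent ℂ fun k => (bind₁ domParamPoly : MvPolynomial (Fin 3 ⊕ Fin 3) ℂ
      →ₐ[ℂ] MvPolynomial (Fin 3) ℂ) ((![X (Sum.inl 0), X (Sum.inr 1), X (Sum.inr 0) - X (Sum.inr 1)] :
        Fin 3 → MvPolynomial (Fin 3 ⊕ Fin 3) ℂ) k) := by
    have h : (fun k => (bind₁ domParamPoly : MvPolynomial (Fin 3 ⊕ Fin 3) ℂ →ₐ[ℂ]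
        MvPolynomial (Fin 3) ℂ) ((![X (Sum.inl 0), X (Sum.inr 1), X (Sum.inr 0) - X (Sum.inr 1)] :
          Fin 3 → MvPolynomial (Fin 3 ⊕ Fin 3) ℂ) k)) = X := by
      funext k
      fin_cases k <;> simp [domParamPoly, bind₁_X_right]
    rw [h]
    exact algebraicIndependent_X (Fin 3) ℂ
  have h := le_zariskiDim_of_algebraicIndependent _ _ vanishingIdeal_dropLast_periodicDomModel_le_ker
    _ hg
  rwa [Fintype.card_fin] at h

/-- **The co-dominant model has no side cylinders.** [folklore] -/
theorem not_isCoordCylinder_periodicDomModel (i : Fin 3) (hi : i ≠ Fin.last 2) :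
    ¬ IsCoordCylinder periodicDomModel (Sum.inr i) := by
  intro h
  have hz : (Sum.elim ![0, 0, 0] ![1, 1, 1] : Fin 3 ⊕ Fin 3 → ℂ) ∈ periodicDomModel := by
    simp [mem_periodicDomModel_iff]
  have hi' : i = 0 ∨ i = 1 := by
    fin_cases i
    · exact Or.inl rfl
    · exact Or.inr rfl
    · exact absurd rfl hi
  rcases hi' with rfl | rfl
  · have h2 := (h _ hz 2).2.1
    simp only [Function.update_apply, reduceCtorEq, if_false, if_true, Sum.inr.injEq,
      Fin.isValue, Sum.elim_inl, Sum.elim_inr, Matrix.cons_val_zero, Matrix.cons_val_one,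
      Matrix.cons_val_two, Matrix.tail_cons, Matrix.head_cons] at h2
    norm_num at h2
  · have h2 := (h _ hz 2).2.1
    simp only [Function.update_apply, reduceCtorEq, if_false, if_true, Sum.inr.injEq,
      Fin.isValue, Sum.elim_inl, Sum.elim_inr, Matrix.cons_val_zero, Matrix.cons_val_one,
      Matrix.cons_val_two, Matrix.tail_cons, Matrix.head_cons] at h2
    norm_num at h2

/-- **The co-dominant model is a certified member of `ECCellPeriodicStdDomNC 2`** — all ten
binders, in order. [folklore] -/
theorem ecCellPeriodicStdDomNC_hypotheses_periodicDomModel :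
    IsIrreducibleClosed ℂ periodicDomModel ∧
    (periodicDomModel ∩ torusLocus ℂ 3).Nonempty ∧
    IsRotund ℂ 3 (periodicDomModel ∩ torusLocus ℂ 3) ∧
    IsAddFree ℂ 3 (periodicDomModel ∩ torusLocus ℂ 3) ∧
    IsMulFree ℂ 3 (periodicDomModel ∩ torusLocus ℂ 3) ∧
    zariskiDim ℂ periodicDomModel = (3 : ℕ) ∧
    addProjDim ℂ 3 periodicDomModel = (2 : ℕ) ∧
    IsPeriodVec ℂ (projAdd '' (periodicDomModel ∩ torusLocus ℂ 3)) (Pi.single (Fin.last 2) 1) ∧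
    zariskiDim ℂ (matrixAct (dropLastMat 2) '' (periodicDomModel ∩ torusLocus ℂ 3)) = (3 : ℕ) ∧
    (∀ i : Fin 3, i ≠ Fin.last 2 → ¬ IsCoordCylinder periodicDomModel (Sum.inr i)) := by
  obtain ⟨h1, h2, h3, h4, h5, h6, h7, -⟩ := cell_hypotheses_periodicDomModel
  exact ⟨h1, h2, h3, h4, h5, h6, h7, isPeriodVec_projAdd_periodicDomModel,
    zariskiDim_dropLast_periodicDomModel, not_isCoordCylinder_periodicDomModel⟩

/-- `ECCellPeriodicStdDomNC 2` ⇒ the co-dominant model meets `Γ_exp`. [folklore] -/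
theorem periodicDomModel_inter_expGraph_nonempty_of_ecCellPeriodicStdDomNC
    (h : ECCellPeriodicStdDomNC 2) : (periodicDomModel ∩ expGraph ℂ 3).Nonempty := by
  obtain ⟨h1, h2, h3, h4, h5, h6, h7, h8, h9, h10⟩ :=
    ecCellPeriodicStdDomNC_hypotheses_periodicDomModel
  exact h _ h1 h2 h3 h4 h5 h6 h7 h8 h9 h10

/-- **Dictionary**: the co-dominant model meets `Γ_exp` iff
`∃ z w, e^z = e^{z²} + w ∧ e^w = e^{z²} + z` — an instance (`g = x₁²`, `κ = (1,1)`, `c = (1,1)`,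
`A = (x₂, x₁)`) of the system solved by the problem side's `exists_expPoint_graphEscape_powers`.
[folklore] -/
theorem periodicDomModel_inter_expGraph_nonempty_iff :
    (periodicDomModel ∩ expGraph ℂ 3).Nonempty ↔
      ∃ z w : ℂ, Complex.exp z = Complex.exp (z ^ 2) + w ∧
        Complex.exp w = Complex.exp (z ^ 2) + z := by
  rw [cell_hypotheses_periodicDomModel.2.2.2.2.2.2.2, preDomModel,
    graphFibreVariety_inter_expGraph_nonempty_iff]
  have key : ∀ x : Fin 2 → ℂ,
      (∀ j, Complex.exp (x j) =
        eval (Fin.cons (Complex.exp (eval x sqBase)) x : Fin (2 + 1) → ℂ) (swapOffsetFibrePoly j)) ↔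
      (Complex.exp (x 0) = Complex.exp (x 0 ^ 2) + x 1 ∧
        Complex.exp (x 1) = Complex.exp (x 0 ^ 2) + x 0) := by
    intro x
    rw [Fin.forall_fin_two, eval_sqBase]
    simp only [swapOffsetFibrePoly, Matrix.cons_val_zero, Matrix.cons_val_one, map_add, eval_X,
      Fin.cons_zero, Fin.cons_one, cons_apply_two]
  constructor
  · rintro ⟨x, hx⟩
    exact ⟨x 0, x 1, (key x).1 hx⟩
  · rintro ⟨z, w, hzw⟩
    refine ⟨![z, w], (key ![z, w]).2 ?_⟩
    simpa using hzw

/-- Problem-side entry point: the conclusion shape of `exists_expPoint_graphEscape_powers` at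
`g = sqBase`, `κ = (1,1)`, `c = (1,1)`, `A = (X 1, X 0)` gives an exponential point of the
co-dominant model. [folklore] -/
theorem periodicDomModel_inter_expGraph_nonempty_of_powers_shape
    (h : ∃ x : Fin 2 → ℂ, ∀ j, Complex.exp (x j) =
      (![1, 1] : Fin 2 → ℂ) j * Complex.exp (eval x sqBase) ^ ((![1, 1] : Fin 2 → ℕ) j) +
        eval x ((![X 1, X 0] : Fin 2 → MvPolynomial (Fin 2) ℂ) j)) :
    (periodicDomModel ∩ expGraph ℂ 3).Nonempty := by
  rw [periodicDomModel_inter_expGraph_nonempty_iff]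
  obtain ⟨x, hx⟩ := h
  refine ⟨x 0, x 1, ?_, ?_⟩
  · simpa [eval_sqBase] using hx 0
  · simpa [eval_sqBase] using hx 1

end Models

end Literature.ModelTheory.Zilber
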